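import Summits.CriticalPhenomena.PercolationContinuityZ3.Theorems.SahiMasterFamilyPhiOrbitUpper

/-!
# Orbit-basis certificate checks with the symbolic recursion SPLIT at the top level (for `n ≥ 8`)

Unit `prim-masterthm-p4` (gen 13; crux anchor stmt-CriticalPhenomena-4575, helper work; memo
`run/shared/lean/prim/prim-masterthm/prim-masterthm-p4/P4-GEN13-REPORT.md` §10; session notes 'F(8) PLAN').  Companion of `…PhiOrbit` /
`…PhiOrbitUpper`.  At `n = 8` the symbolic Lieb–Sahi recursion `symEN 8 8` (resp. `symEV 8`) is about ten times the kernel work of `n = 7` and does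
not fit one declaration.  Its top level is a sum of `n − 1` order-`(n−1)` recursions plus one product, so it can be evaluated in SEPARATE declarations:
given kernel-checked normal forms `P i` of the sub-recursions and `Pt` of the tail recursion, `symEN_split` / `symEV_split` rewrite the order-`n`
recursion as `normP (Σ_i P i ++ (−1)·(Pt · x_{S 0}))`, and `phiNonneg_of_orbitPiecesSplit` / `phiLeTopGap_of_orbitPiecesSplitU` are the corresponding
assembly theorems (the `R`-piece is then stated with the `P i`, `Pt` as explicit data).  No data here.  Axioms standard. [this work]
-/

set_option autoImplicit false

namespace Summit.CriticalPhenomena.PercolationContinuityZ3.Theorems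

namespace PhiCert

open Finset

/-- **Top-level split of `symEN`**: with the sub-recursions in normal form `P i` and `Pt`,
`symEN n (m+2) L = normP (Σ_i P i ++ (−1)·(Pt·mono (L 0)))`. [this work] -/
theorem symEN_split (n m : ℕ) (L : Fin (m + 2) → ℕ) (P : Fin (m + 1) → Poly) (Pt : Poly)
    (hP : ∀ i, symEN n (m + 1) (Function.update (Fin.tail L) i (Fin.tail L i ||| L 0)) = P i)
    (hPt : symEN n (m + 1) (Fin.tail L) = Pt) :
    symEN n (m + 2) L =
      normP ((List.finRange (m + 1)).foldr (fun i acc => P i ++ acc) [] ++ scaleP (-1) (mulP Pt (mono n (L 0)))) := by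
  rw [symEN]
  simp only [hP, hPt]

/-- **Top-level split of `symEV`** (no top substitution). [this work] -/
theorem symEV_split (m : ℕ) (L : Fin (m + 2) → ℕ) (P : Fin (m + 1) → Poly) (Pt : Poly)
    (hP : ∀ i, symEV (m + 1) (Function.update (Fin.tail L) i (Fin.tail L i ||| L 0)) = P i)
    (hPt : symEV (m + 1) (Fin.tail L) = Pt) :
    symEV (m + 2) L =
      normP ((List.finRange (m + 1)).foldr (fun i acc => P i ++ acc) [] ++ scaleP (-1) (mulP Pt (monoV (L 0)))) := by
  rw [symEV]
  simp only [hP, hPt]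

/-- **Assembly for `F(n+2)` with the split recursion**: the `R`-piece is stated with the sub-recursion normal forms `P i`, `Pt` as data.
[this work] -/
theorem phiNonneg_of_orbitPiecesSplit (n M : ℕ) (hM : 0 < M) (C : List (ℤ × List Atom)) (D : List (ℤ × List ℕ × Mono)) (RD : Poly)
    (P : Fin (n + 1) → Poly) (Pt : Poly)
    (hP : ∀ i, symEN (n + 2) (n + 1)
      (Function.update (Fin.tail (fun j : Fin (n + 2) => 2 ^ (j : ℕ))) i
        (Fin.tail (fun j : Fin (n + 2) => 2 ^ (j : ℕ)) i ||| (fun j : Fin (n + 2) => 2 ^ (j : ℕ)) 0)) = P i)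
    (hPt : symEN (n + 2) (n + 1) (Fin.tail (fun j : Fin (n + 2) => 2 ^ (j : ℕ))) = Pt)
    (hT : checkT C = true) (hDZ : checkDZ (n + 2) D = true)
    (hR : normP (termsPolyN (n + 2) C ++ scaleP (-(M : ℤ))
      (normP ((List.finRange (n + 1)).foldr (fun i acc => P i ++ acc) [] ++
        scaleP (-1) (mulP Pt (mono (n + 2) ((fun j : Fin (n + 2) => 2 ^ (j : ℕ)) 0)))))) = RD)
    (hrec : D.map (recon (n + 2)) = RD) :
    PrincipalCapBeta.PhiNonneg (n + 2) := by
  have e := symEN_split (n + 2) n (fun j : Fin (n + 2) => 2 ^ (j : ℕ)) P Pt hP hPt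
  have hR' : normP (termsPolyN (n + 2) C ++ scaleP (-(M : ℤ)) (symEN (n + 2) (n + 2) fun j : Fin (n + 2) => 2 ^ (j : ℕ))) = RD := by
    rw [e]; exact hR
  exact phiNonneg_of_orbitPieces' (n + 1) M hM C D RD hT hDZ hR' hrec

/-- **Assembly for `U(n+2)` with the split recursion.** [this work] -/
theorem phiLeTopGap_of_orbitPiecesSplitU (n M : ℕ) (hM : 0 < M) (C : List (ℤ × List Atom)) (D : List (ℤ × List ℕ × Mono)) (RD : Poly)
    (P : Fin (n + 1) → Poly) (Pt : Poly)
    (hP : ∀ i, symEV (n + 1)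
      (Function.update (Fin.tail (fun j : Fin (n + 2) => 2 ^ (j : ℕ))) i
        (Fin.tail (fun j : Fin (n + 2) => 2 ^ (j : ℕ)) i ||| (fun j : Fin (n + 2) => 2 ^ (j : ℕ)) 0)) = P i)
    (hPt : symEV (n + 1) (Fin.tail (fun j : Fin (n + 2) => 2 ^ (j : ℕ))) = Pt)
    (hT : checkTU C = true) (hDZ : checkDZ (n + 2) D = true)
    (hR : normP (termsPolyNV C ++ scaleP (-(M : ℤ))
      ([([2 ^ (n + 2) - 1], ((n + 2 - 1).factorial : ℤ)), (singletonsMono (n + 2), -((n + 2 - 1).factorial : ℤ))] ++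
        scaleP (-1) (normP ((List.finRange (n + 1)).foldr (fun i acc => P i ++ acc) [] ++
          scaleP (-1) (mulP Pt (monoV ((fun j : Fin (n + 2) => 2 ^ (j : ℕ)) 0))))))) = RD)
    (hrec : D.map (recon (n + 2)) = RD) :
    UpperMaster.PhiLeTopGap (n + 2) := by
  have e := symEV_split n (fun j : Fin (n + 2) => 2 ^ (j : ℕ)) P Pt hP hPt
  have hR' : normP (termsPolyNV C ++ scaleP (-(M : ℤ)) (targetU (n + 2))) = RD := by
    rw [targetU, e]; exact hR
  exact phiLeTopGap_of_orbitPiecesU (n + 1) M hM C D RD hT hDZ hR' hrec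

/-- Splitting the relabelling check over a concatenation of data blocks (to respect file-size limits). [this work] -/
theorem recon_append (n : ℕ) (D₁ D₂ : List (ℤ × List ℕ × Mono)) (R₁ R₂ : Poly)
    (h₁ : D₁.map (recon n) = R₁) (h₂ : D₂.map (recon n) = R₂) : (D₁ ++ D₂).map (recon n) = R₁ ++ R₂ := by
  rw [List.map_append, h₁, h₂]

end PhiCert

end Summit.CriticalPhenomena.PercolationContinuityZ3.Theorems
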